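import Summits.Parity.BatemanHorn.Theorems.SoloInformedTwinBalancedSplit

/-!
# SoloInformedTwinWindowForms — the twin balanced window as two linear-pair window sums

Solo unit `solo-Parity-informed` (ideation tier, informed mode), session 82; `paper.md` §20
((F)-kernel project), CLAIMS C171.

The kernel's balanced window `twinBalancedWindowSum x y z Y` (C120) sums, over divisor pairs
`(e₁, e₂)` with `z < min(e₁,e₂)`, `y < e₁e₂ ≤ Y`, the weight `μ(e₁)μ(e₂) log²(e₁e₂)` times the
pair count `N(e₁,e₂;x) = #{n ≤ x odd : e₁ ∣ n, e₂ ∣ n+2} + #{m ≤ x/2 : e₁ ∣ m, e₂ ∣ m+1}`.  This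
file rewrites it, for the prose parameters `y = ⌊x^{1-η}⌋`, `z = ⌊x^σ⌋ = balanceCut (1/2-σ)`,
`Y = ⌊x^{1+θ}⌋`, as the sum of the two LINEAR-PAIR window sums of the Literature package
`Literature.NumberTheory.Sieve.LinearPair*` (window `x^{1-η} < d₀d₁ ≤ x^{1+θ}`, `x^σ < dᵢ`, count
`#{0 < n ≤ X : d₀ ∣ q₀n + a₀, d₁ ∣ q₁n + a₁}`):

* odd `n = 2k - 1 ≤ x`:  forms `(q₀,a₀) = (2,-1)`, `(q₁,a₁) = (2,1)`, count length `X = ⌈x/2⌉`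
  (`card_odd_twin_filter_eq`);
* `m ≤ x/2`:  forms `(1,0)`, `(1,1)`, count length `X = ⌊x/2⌋` (`card_even_twin_filter_eq`);
* `twin_window_iff` — the integer window conditions are the real ones;
* `twinBalancedWindowSum_eq_forms` — the identity.

No analysis here; the estimate is `SoloInformedTwinWindowDFI`.
-/

namespace Summit.Parity.BatemanHorn.Theorems

open Finset Filter Asymptotics ArithmeticFunction
open scoped ArithmeticFunction.Moebius

namespace PairWindow

/-- Odd `n ≤ x` with `e₁ ∣ n`, `e₂ ∣ n + 2` ↔ `k ≤ ⌈x/2⌉` with `e₁ ∣ 2k - 1`, `e₂ ∣ 2k + 1`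
(`n = 2k - 1`), counted in the Literature package's form. -/
theorem card_odd_twin_filter_eq (x e₁ e₂ : ℕ) :
    (((Icc 1 x).filter Odd).filter (fun n => e₁ ∣ n ∧ e₂ ∣ n + 2)).card =
      ((Ioc 0 ((x + 1) / 2)).filter (fun k : ℕ =>
        (e₁ : ℤ) ∣ ((2 : ℕ) : ℤ) * k + (-1) ∧ (e₂ : ℤ) ∣ ((2 : ℕ) : ℤ) * k + 1)).card := by
  have key : ((Icc 1 x).filter Odd).filter (fun n => e₁ ∣ n ∧ e₂ ∣ n + 2) =
      ((Ioc 0 ((x + 1) / 2)).filter (fun k : ℕ =>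
        (e₁ : ℤ) ∣ ((2 : ℕ) : ℤ) * k + (-1) ∧ (e₂ : ℤ) ∣ ((2 : ℕ) : ℤ) * k + 1)).map
        ⟨fun k => 2 * k - 1, fun a b h => by simp only at h; omega⟩ := by
    ext n
    simp only [Finset.mem_filter, Finset.mem_map, Finset.mem_Icc, Finset.mem_Ioc,
      Function.Embedding.coeFn_mk]
    constructor
    · rintro ⟨⟨⟨h1, hx⟩, hodd⟩, hd₁, hd₂⟩
      obtain ⟨m, rfl⟩ := hodd
      refine ⟨m + 1, ⟨⟨by omega, by omega⟩, ?_, ?_⟩, by omega⟩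
      · have h : ((2 : ℕ) : ℤ) * ((m + 1 : ℕ) : ℤ) + (-1) = ((2 * m + 1 : ℕ) : ℤ) := by
          push_cast; ring
        rw [h, Int.natCast_dvd_natCast]
        exact hd₁
      · have h : ((2 : ℕ) : ℤ) * ((m + 1 : ℕ) : ℤ) + 1 = ((2 * m + 1 + 2 : ℕ) : ℤ) := by
          push_cast; ring
        rw [h, Int.natCast_dvd_natCast]
        exact hd₂
    · rintro ⟨k, ⟨⟨hk0, hkx⟩, hd₁, hd₂⟩, rfl⟩
      have h2k : 1 ≤ 2 * k := by omega
      refine ⟨⟨⟨by omega, by omega⟩, ⟨k - 1, by omega⟩⟩, ?_, ?_⟩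
      · have h : ((2 : ℕ) : ℤ) * (k : ℤ) + (-1) = ((2 * k - 1 : ℕ) : ℤ) := by
          rw [Nat.cast_sub h2k]; push_cast; ring
        rw [h, Int.natCast_dvd_natCast] at hd₁
        exact hd₁
      · have h : ((2 : ℕ) : ℤ) * (k : ℤ) + 1 = ((2 * k - 1 + 2 : ℕ) : ℤ) := by
          rw [show 2 * k - 1 + 2 = 2 * k + 1 by omega]; push_cast; ring
        rw [h, Int.natCast_dvd_natCast] at hd₂
        exact hd₂
  rw [key, Finset.card_map]

/-- `m ≤ x/2` with `e₁ ∣ m`, `e₂ ∣ m + 1`, counted in the Literature package's form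
(forms `(1,0)`, `(1,1)`). -/
theorem card_even_twin_filter_eq (x e₁ e₂ : ℕ) :
    ((Icc 1 (x / 2)).filter (fun m => e₁ ∣ m ∧ e₂ ∣ m + 1)).card =
      ((Ioc 0 (x / 2)).filter (fun m : ℕ =>
        (e₁ : ℤ) ∣ ((1 : ℕ) : ℤ) * m + 0 ∧ (e₂ : ℤ) ∣ ((1 : ℕ) : ℤ) * m + 1)).card := by
  congr 1
  ext m
  simp only [Finset.mem_filter, Finset.mem_Icc, Finset.mem_Ioc]
  have h₀ : ((1 : ℕ) : ℤ) * (m : ℤ) + 0 = ((m : ℕ) : ℤ) := by push_cast; ring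
  have h₁ : ((1 : ℕ) : ℤ) * (m : ℤ) + 1 = ((m + 1 : ℕ) : ℤ) := by push_cast; ring
  rw [h₀, h₁, Int.natCast_dvd_natCast, Int.natCast_dvd_natCast]
  constructor
  · rintro ⟨⟨h1, h2⟩, hd⟩
    exact ⟨⟨by omega, h2⟩, hd⟩
  · rintro ⟨⟨h1, h2⟩, hd⟩
    exact ⟨⟨by omega, h2⟩, hd⟩

/-- The pair count in the package's coordinates. -/
theorem twinPairCount_eq_forms (x e₁ e₂ : ℕ) :
    twinPairCount x e₁ e₂ =
      ((((Ioc 0 ((x + 1) / 2)).filter (fun k : ℕ =>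
          (e₁ : ℤ) ∣ ((2 : ℕ) : ℤ) * k + (-1) ∧ (e₂ : ℤ) ∣ ((2 : ℕ) : ℤ) * k + 1)).card : ℕ) : ℝ)
      + ((((Ioc 0 (x / 2)).filter (fun m : ℕ =>
          (e₁ : ℤ) ∣ ((1 : ℕ) : ℤ) * m + 0 ∧ (e₂ : ℤ) ∣ ((1 : ℕ) : ℤ) * m + 1)).card : ℕ) : ℝ) := by
  unfold twinPairCount
  rw [card_odd_twin_filter_eq, card_even_twin_filter_eq]

/-- The integer window conditions of the kernel, with `y = ⌊x^{1-η}⌋`, `z = ⌊x^σ⌋`,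
`Y = ⌊x^{1+θ}⌋`, are the real window conditions of the package. -/
theorem twin_window_iff (σ θ η : ℝ) (x e₁ e₂ : ℕ) :
    ((balanceCut (1 / 2 - σ) x < min e₁ e₂ ∧ e₁ * e₂ ≤ productLevel θ x) ∧
        rpowCut η x < e₁ * e₂) ↔
      ((x : ℝ) ^ (1 - η) < (e₁ : ℝ) * e₂ ∧ (e₁ : ℝ) * e₂ ≤ (x : ℝ) ^ (1 + θ) ∧
        (x : ℝ) ^ σ < (e₁ : ℝ) ∧ (x : ℝ) ^ σ < (e₂ : ℝ)) := by
  have h0 : (0 : ℝ) ≤ x := Nat.cast_nonneg x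
  have hfl : ∀ t : ℝ, 0 ≤ t → ∀ n : ℕ, ⌊t⌋₊ < n ↔ t < n := fun t ht n => Nat.floor_lt ht
  have hle : ∀ t : ℝ, 0 ≤ t → ∀ n : ℕ, n ≤ ⌊t⌋₊ ↔ (n : ℝ) ≤ t := fun t ht n => Nat.le_floor_iff ht
  simp only [balanceCut, productLevel, rpowCut, lt_min_iff]
  rw [show (1 : ℝ) / 2 - (1 / 2 - σ) = σ by ring]
  rw [hfl _ (Real.rpow_nonneg h0 σ) e₁, hfl _ (Real.rpow_nonneg h0 σ) e₂,
    hle _ (Real.rpow_nonneg h0 (1 + θ)), hfl _ (Real.rpow_nonneg h0 (1 - η))]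
  push_cast
  tauto

/-- One term of the identity. -/
theorem twin_window_term_eq (σ θ η : ℝ) (x e₁ e₂ : ℕ) :
    (if balanceCut (1 / 2 - σ) x < min e₁ e₂ ∧ e₁ * e₂ ≤ productLevel θ x then
        twinPairTerm x (rpowCut η x) e₁ e₂ else 0) =
      (if ((x : ℝ) ^ (1 - η) < (e₁ : ℝ) * e₂ ∧ (e₁ : ℝ) * e₂ ≤ (x : ℝ) ^ (1 + θ) ∧
            (x : ℝ) ^ σ < (e₁ : ℝ) ∧ (x : ℝ) ^ σ < (e₂ : ℝ)) then
          (μ e₁ : ℝ) * (μ e₂ : ℝ) * Real.log ((e₁ : ℝ) * e₂) ^ 2 else 0) *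
        ((((Ioc 0 ((x + 1) / 2)).filter (fun k : ℕ =>
          (e₁ : ℤ) ∣ ((2 : ℕ) : ℤ) * k + (-1) ∧ (e₂ : ℤ) ∣ ((2 : ℕ) : ℤ) * k + 1)).card : ℕ) : ℝ)
      + (if ((x : ℝ) ^ (1 - η) < (e₁ : ℝ) * e₂ ∧ (e₁ : ℝ) * e₂ ≤ (x : ℝ) ^ (1 + θ) ∧
            (x : ℝ) ^ σ < (e₁ : ℝ) ∧ (x : ℝ) ^ σ < (e₂ : ℝ)) then
          (μ e₁ : ℝ) * (μ e₂ : ℝ) * Real.log ((e₁ : ℝ) * e₂) ^ 2 else 0) *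
        ((((Ioc 0 (x / 2)).filter (fun m : ℕ =>
          (e₁ : ℤ) ∣ ((1 : ℕ) : ℤ) * m + 0 ∧ (e₂ : ℤ) ∣ ((1 : ℕ) : ℤ) * m + 1)).card : ℕ) : ℝ) := by
  have hiff := twin_window_iff σ θ η x e₁ e₂
  have hlog : Real.log ((e₁ * e₂ : ℕ) : ℝ) = Real.log ((e₁ : ℝ) * e₂) := by push_cast; rfl
  unfold twinPairTerm
  rw [twinPairCount_eq_forms, hlog]
  by_cases hw : ((x : ℝ) ^ (1 - η) < (e₁ : ℝ) * e₂ ∧ (e₁ : ℝ) * e₂ ≤ (x : ℝ) ^ (1 + θ) ∧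
      (x : ℝ) ^ σ < (e₁ : ℝ) ∧ (x : ℝ) ^ σ < (e₂ : ℝ))
  · obtain ⟨hout, hin⟩ := hiff.mpr hw
    rw [if_pos hout, if_pos hin, if_pos hw]
    ring
  · rw [if_neg hw, zero_mul, zero_mul, zero_add]
    by_cases hout : balanceCut (1 / 2 - σ) x < min e₁ e₂ ∧ e₁ * e₂ ≤ productLevel θ x
    · have hin : ¬ rpowCut η x < e₁ * e₂ := fun hin => hw (hiff.mp ⟨hout, hin⟩)
      rw [if_pos hout, if_neg hin, zero_mul]
    · rw [if_neg hout]

/-- **The twin balanced window as two linear-pair window sums.**  With `y = ⌊x^{1-η}⌋`,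
`z = ⌊x^σ⌋`, `Y = ⌊x^{1+θ}⌋`:
`W(x) = Σ_{e ≤ x+2} [x^{1-η} < e₁e₂ ≤ x^{1+θ}, x^σ < eᵢ] μ(e₁)μ(e₂)log²(e₁e₂)
          · (#{0 < k ≤ ⌈x/2⌉ : e₁ ∣ 2k-1, e₂ ∣ 2k+1} + #{0 < m ≤ ⌊x/2⌋ : e₁ ∣ m, e₂ ∣ m+1})`,
the two counts written as the package's `#{0 < n ≤ X : d₀ ∣ q₀n + a₀, d₁ ∣ q₁n + a₁}` for the
forms `(2,-1),(2,1)` and `(1,0),(1,1)`. -/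
theorem twinBalancedWindowSum_eq_forms (σ θ η : ℝ) (x : ℕ) :
    twinBalancedWindowSum x (rpowCut η x) (balanceCut (1 / 2 - σ) x) (productLevel θ x) =
      (∑ e₁ ∈ Icc 1 (x + 2), ∑ e₂ ∈ Icc 1 (x + 2),
        (if ((x : ℝ) ^ (1 - η) < (e₁ : ℝ) * e₂ ∧ (e₁ : ℝ) * e₂ ≤ (x : ℝ) ^ (1 + θ) ∧
              (x : ℝ) ^ σ < (e₁ : ℝ) ∧ (x : ℝ) ^ σ < (e₂ : ℝ)) then
            (μ e₁ : ℝ) * (μ e₂ : ℝ) * Real.log ((e₁ : ℝ) * e₂) ^ 2 else 0) *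
          ((((Ioc 0 ((x + 1) / 2)).filter (fun k : ℕ =>
            (e₁ : ℤ) ∣ ((2 : ℕ) : ℤ) * k + (-1) ∧ (e₂ : ℤ) ∣ ((2 : ℕ) : ℤ) * k + 1)).card : ℕ) :
              ℝ))
      + ∑ e₁ ∈ Icc 1 (x + 2), ∑ e₂ ∈ Icc 1 (x + 2),
        (if ((x : ℝ) ^ (1 - η) < (e₁ : ℝ) * e₂ ∧ (e₁ : ℝ) * e₂ ≤ (x : ℝ) ^ (1 + θ) ∧
              (x : ℝ) ^ σ < (e₁ : ℝ) ∧ (x : ℝ) ^ σ < (e₂ : ℝ)) then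
            (μ e₁ : ℝ) * (μ e₂ : ℝ) * Real.log ((e₁ : ℝ) * e₂) ^ 2 else 0) *
          ((((Ioc 0 (x / 2)).filter (fun m : ℕ =>
            (e₁ : ℤ) ∣ ((1 : ℕ) : ℤ) * m + 0 ∧ (e₂ : ℤ) ∣ ((1 : ℕ) : ℤ) * m + 1)).card : ℕ) :
              ℝ) := by
  unfold twinBalancedWindowSum
  rw [← Finset.sum_add_distrib]
  refine Finset.sum_congr rfl fun e₁ _ => ?_
  rw [← Finset.sum_add_distrib]
  refine Finset.sum_congr rfl fun e₂ _ => ?_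
  exact twin_window_term_eq σ θ η x e₁ e₂

end PairWindow

end Summit.Parity.BatemanHorn.Theorems
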